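import Mathlib.Tactic.Group
import Mathlib.Tactic.FinCases
import Mathlib.GroupTheory.QuotientGroup.Basic
import Literature.Topology.FourManifolds.MillerSchuppACSeries
import Literature.Topology.FourManifolds.MillerSchuppRankOne
import Literature.Barriers.SmoothPoincare4.PropertyTwoRAndrewsCurtis
import HarnessLib

/-!
# Automorphic images of the Akbulut–Kirby presentations (Panteleev–Ushakov 2019, §3)

Free-group automorphisms are *not* Andrews–Curtis moves, and it is open whether adjoining them
to the three elementary moves changes the equivalence relation on balanced presentations of the
trivial group (Panteleev–Ushakov 2019, §3, first paragraph).  For the Akbulut–Kirby presentations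
`AK(n) = ⟨x, y ∣ xⁿ = yⁿ⁺¹, xyx = yxy⟩` Panteleev and Ushakov prove (Prop. 3.7, from Lemmas 3.4–3.6,
move tables found by computer) that every automorphic image `φ(AK(n))`, `φ ∈ Aut F₂`, is
Andrews–Curtis equivalent to `AK(n)` by elementary moves alone, so that the Andrews–Curtis class of
`AK(n)` is `Aut F₂`-invariant (Cor. 3.8).

This file formalises, uniformly in `n = k + 2`, the two generators of the *signed permutation*
subgroup that need no search:

* `isAndrewsCurtisEquivalent_akbulutKirby_gstPresentation` — **Lemma 3.4** (generator swap
  `x ↔ y`): `AK(n)` is Andrews–Curtis equivalent to `⟨x, y ∣ yxy = xyx, xⁿ⁺¹ = yⁿ⟩`, which is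
  literally the tree's Gompf–Scharlemann–Thompson presentation `gstPresentation n`
  (`gstPresentation_eq_swap_akbulutKirby`).  The published three-line proof: the braid relator is
  carried to its own inverse by the swap, and conjugation by the Garside element `Δ = xyx`
  exchanges `x` and `y` modulo the braid relator, so it carries `xⁿy⁻⁽ⁿ⁺¹⁾` to `yⁿx⁻⁽ⁿ⁺¹⁾` up to a
  consequence of the other relator;
* `isAndrewsCurtisEquivalent_akbulutKirby_invGenerators` — inversion of both generators
  `x ↦ x⁻¹, y ↦ y⁻¹` (each Akbulut–Kirby relator goes to a conjugate of its inverse);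

and the formal consequences: the swap form `FreeGroup.map (swap 0 1) ∘ akbulutKirby k`
(`isAndrewsCurtisEquivalent_akbulutKirby_swap`; relator reordering `acPair_swap` and
`comp_vec_two` are reused from `MillerSchuppRankOne`), closure under composition
(`IsAndrewsCurtisEquivalent.comp_comp_of_comp`, Lemma 3.3 loc. cit.), and the sharpening of the
tree's `isAndrewsCurtisEquivalent_gstPresentation_trivial_iff` from Andrews–Curtis *triviality* to
the full Andrews–Curtis *class*: `IsAndrewsCurtisEquivalent (gstPresentation (k + 2)) Q ↔
IsAndrewsCurtisEquivalent (akbulutKirby k) Q` for every `Q`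
(`isAndrewsCurtisEquivalent_gstPresentation_iff_akbulutKirby`).  Lemma 3.5 (`y ↦ y⁻¹`) and
Lemma 3.6 (`y ↦ yx`), whose published move tables use `n`-dependent conjugators, are not
formalised here.

## Sources

* D. Panteleev, A. Ushakov, *Conjugacy search problem and the Andrews–Curtis conjecture*, Groups
  Complex. Cryptol. 11 (2019) 43–60, arXiv:1609.00325, §3 (Lemmas 3.2–3.4, Prop. 3.7, Cor. 3.8).
  [PanteleevUshakov2016]
* S. Akbulut, R. Kirby, *A potential smooth counterexample in dimension 4 …*, Topology 24 (1985)
  375–390 (the presentations). [AkbulutKirby1985]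
* R. E. Gompf, M. Scharlemann, A. Thompson, *Fibered knots and potential counterexamples to the
  property 2R and slice-ribbon conjectures*, Geom. Topol. 14 (2010) 2305–2347, §7.
  [GompfScharlemannThompson2010]
* J. J. Andrews, M. L. Curtis, *Free groups and handlebodies*, Proc. AMS 16 (1965) 192–195.
  [AndrewsCurtis1965]
-/

namespace Literature.Barriers.SmoothPoincare4

open Function Literature.Topology.FourManifolds

/-! ### Closure under composition -/

/-- **Panteleev–Ushakov 2019, Lemma 3.3 (closure under composition).**  If `P` is Andrews–Curtis
equivalent to `φ ∘ P` and to `ψ ∘ P` for endomorphisms `φ, ψ` of the free group, then also to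
`φ ∘ ψ ∘ P` (apply `φ` to the second equivalence and compose with the first).
[cite: PanteleevUshakov2016, Lemma 3.3] -/
theorem IsAndrewsCurtisEquivalent.comp_comp_of_comp {m : ℕ} {F : Type*}
    [FunLike F (FreeGroup (Fin m)) (FreeGroup (Fin m))]
    [MonoidHomClass F (FreeGroup (Fin m)) (FreeGroup (Fin m))]
    (φ ψ : F) {P : BalancedPresentation m}
    (hφ : IsAndrewsCurtisEquivalent P (⇑φ ∘ P)) (hψ : IsAndrewsCurtisEquivalent P (⇑ψ ∘ P)) :
    IsAndrewsCurtisEquivalent P (⇑φ ∘ ⇑ψ ∘ P) :=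
  hφ.trans (hψ.map φ)

/-! ### Lemma 3.4: the generator swap, `AK(n) ~ GST(n)` -/

/-- **Panteleev–Ushakov 2019, Lemma 3.4, in the tree's terms: `AK(n)` is Andrews–Curtis equivalent
to `GST(n) = ⟨x, y ∣ yxy = xyx, xⁿ⁺¹ = yⁿ⟩`, its image under the generator swap** (`n = k + 2`;
the argument is uniform in `n`).  Moves: multiply `r₀ = xⁿy⁻⁽ⁿ⁺¹⁾` by the consequence `r₀⁻¹φ(r₀)`
of the braid relator `r₁`, where `φ(x) = Δ⁻¹yΔ`, `φ(y) = Δ⁻¹xΔ`, `Δ = xyx` (`φ` is the identity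
modulo `r₁`: `ΔxΔ⁻¹y⁻¹ = r₁` and `Δy = xΔ` modulo `r₁`); conjugate `r₀` by `Δ`; invert both
relators; list them in the other order. [cite: PanteleevUshakov2016, Lemma 3.4] -/
theorem isAndrewsCurtisEquivalent_akbulutKirby_gstPresentation (k : ℕ) :
    IsAndrewsCurtisEquivalent (akbulutKirby k) (gstPresentation (k + 2)) := by
  set x : FreeGroup (Fin 2) := FreeGroup.of 0 with hx
  set y : FreeGroup (Fin 2) := FreeGroup.of 1 with hy
  set r : FreeGroup (Fin 2) := x * y * x * (y * x * y)⁻¹ with hr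
  set p : FreeGroup (Fin 2) := x ^ (k + 2) * (y ^ (k + 3))⁻¹ with hp
  have e : akbulutKirby k = ![p, r] := rfl
  have fin : gstPresentation (k + 2) =
      ![y * x * y * (x * y * x)⁻¹, x ^ (k + 2 + 1) * (y ^ (k + 2))⁻¹] := rfl
  rw [e, fin]
  -- Step 1: substitute `x ↦ Δ⁻¹yΔ`, `y ↦ Δ⁻¹xΔ` in `r₀`, i.e. multiply `r₀` by `r₀⁻¹ φ(r₀) ∈ ⟪r₁⟫`.
  set φ : FreeGroup (Fin 2) →* FreeGroup (Fin 2) :=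
    FreeGroup.lift ![(x * y * x)⁻¹ * y * (x * y * x), (x * y * x)⁻¹ * x * (x * y * x)] with hφ
  have hmem : p⁻¹ * φ p ∈ Subgroup.normalClosure ((![p, r] : BalancedPresentation 2) '' {1}) := by
    have hS : ((![p, r] : BalancedPresentation 2) '' {1}) = {r} := by
      rw [Set.image_singleton]; rfl
    rw [hS]
    haveI : (Subgroup.normalClosure ({r} : Set (FreeGroup (Fin 2)))).Normal :=
      Subgroup.normalClosure_normal
    -- the braid relation holds in `F₂ ⧸ ⟪r⟫`: `(xyx)⁻¹(yxy) = (yxy)⁻¹ r⁻¹ (yxy) ∈ ⟪r⟫`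
    have hxyx : ((x * y * x : FreeGroup (Fin 2)) : FreeGroup (Fin 2) ⧸ Subgroup.normalClosure
        ({r} : Set (FreeGroup (Fin 2)))) = (y * x * y : FreeGroup (Fin 2)) := by
      refine QuotientGroup.eq.2 ?_
      have e₁ : (x * y * x)⁻¹ * (y * x * y) = (y * x * y)⁻¹ * r⁻¹ * (y * x * y)⁻¹⁻¹ := by
        rw [hr]; group
      rw [e₁]
      exact (Subgroup.normalClosure_normal (s := ({r} : Set (FreeGroup (Fin 2))))).conj_mem _
        (Subgroup.inv_mem _ (Subgroup.subset_normalClosure rfl)) _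
    have hrel : (x : FreeGroup (Fin 2) ⧸ Subgroup.normalClosure ({r} : Set (FreeGroup (Fin 2)))) *
        y * x = (y : FreeGroup (Fin 2) ⧸ Subgroup.normalClosure ({r} : Set (FreeGroup (Fin 2)))) *
        x * y := by
      simpa only [QuotientGroup.mk_mul] using hxyx
    refine inv_mul_lift_mem_of_forall_generator
      ![(x * y * x)⁻¹ * y * (x * y * x), (x * y * x)⁻¹ * x * (x * y * x)] _
      (Fin.forall_fin_two.2 ⟨?_, ?_⟩) p
    · -- `x⁻¹ · Δ⁻¹ y Δ ∈ ⟪r⟫`, since `yΔ = Δx` modulo `r`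
      have e₁ : (FreeGroup.of (0 : Fin 2))⁻¹ *
          (![(x * y * x)⁻¹ * y * (x * y * x), (x * y * x)⁻¹ * x * (x * y * x)] :
            Fin 2 → FreeGroup (Fin 2)) 0 = x⁻¹ * ((x * y * x)⁻¹ * y * (x * y * x)) := by
        simp only [Matrix.cons_val_zero]; rw [← hx]
      rw [e₁, ← QuotientGroup.eq_one_iff]
      simp only [QuotientGroup.mk_mul, QuotientGroup.mk_inv]
      set X := (x : FreeGroup (Fin 2) ⧸ Subgroup.normalClosure ({r} : Set (FreeGroup (Fin 2))))
      set Y := (y : FreeGroup (Fin 2) ⧸ Subgroup.normalClosure ({r} : Set (FreeGroup (Fin 2))))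
      have h2 : Y * (X * Y * X) = X * Y * X * X := by
        calc Y * (X * Y * X) = (Y * X * Y) * X := by group
          _ = (X * Y * X) * X := by rw [← hrel]
      calc X⁻¹ * ((X * Y * X)⁻¹ * Y * (X * Y * X))
            = X⁻¹ * (X * Y * X)⁻¹ * (Y * (X * Y * X)) := by group
        _ = X⁻¹ * (X * Y * X)⁻¹ * (X * Y * X * X) := by rw [h2]
        _ = 1 := by group
    · -- `y⁻¹ · Δ⁻¹ x Δ ∈ ⟪r⟫`, since `xΔ = Δy` modulo `r`
      have e₁ : (FreeGroup.of (1 : Fin 2))⁻¹ *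
          (![(x * y * x)⁻¹ * y * (x * y * x), (x * y * x)⁻¹ * x * (x * y * x)] :
            Fin 2 → FreeGroup (Fin 2)) 1 = y⁻¹ * ((x * y * x)⁻¹ * x * (x * y * x)) := by
        simp only [Matrix.cons_val_one, Matrix.cons_val_zero]; rw [← hy]
      rw [e₁, ← QuotientGroup.eq_one_iff]
      simp only [QuotientGroup.mk_mul, QuotientGroup.mk_inv]
      set X := (x : FreeGroup (Fin 2) ⧸ Subgroup.normalClosure ({r} : Set (FreeGroup (Fin 2))))
      set Y := (y : FreeGroup (Fin 2) ⧸ Subgroup.normalClosure ({r} : Set (FreeGroup (Fin 2))))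
      have h2 : X * (X * Y * X) = X * Y * X * Y := by
        calc X * (X * Y * X) = X * (Y * X * Y) := by rw [← hrel]
          _ = X * Y * X * Y := by group
      calc Y⁻¹ * ((X * Y * X)⁻¹ * X * (X * Y * X))
            = Y⁻¹ * (X * Y * X)⁻¹ * (X * (X * Y * X)) := by group
        _ = Y⁻¹ * (X * Y * X)⁻¹ * (X * Y * X * Y) := by rw [h2]
        _ = 1 := by group
  have step := IsAndrewsCurtisEquivalent.update_mul_of_mem_normalClosure
    (![p, r] : BalancedPresentation 2) (i := 0) (S := {1}) (by decide) hmem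
  have eupd : update (![p, r] : BalancedPresentation 2) 0
      ((![p, r] : BalancedPresentation 2) 0 * (p⁻¹ * φ p)) = ![φ p, r] := by
    ext i; fin_cases i <;> simp
  rw [eupd] at step
  refine step.trans ?_
  -- `φ(r₀) = Δ⁻¹ (yⁿ x⁻⁽ⁿ⁺¹⁾) Δ`, `Δ = xyx`
  have hφp : φ p = (x * y * x)⁻¹ * (y ^ (k + 2) * (x ^ (k + 3))⁻¹) * (x * y * x) := by
    have hφx : φ x = (x * y * x)⁻¹ * y * (x * y * x)⁻¹⁻¹ := by
      rw [hφ, hx, FreeGroup.lift_apply_of, inv_inv]; rfl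
    have hφy : φ y = (x * y * x)⁻¹ * x * (x * y * x)⁻¹⁻¹ := by
      rw [hφ, hy, FreeGroup.lift_apply_of, inv_inv]; rfl
    rw [hp, map_mul, map_inv, map_pow, map_pow, hφx, hφy, conj_pow, conj_pow]
    group
  rw [hφp]
  -- Step 2: conjugate `r₀` by `Δ`.  Step 3: invert both relators.  Step 4: reorder.
  refine (acPair_conj₀ (x * y * x) (u' := y ^ (k + 2) * (x ^ (k + 3))⁻¹) (by group)).trans ?_
  refine (acPair_inv₀ (u' := x ^ (k + 2 + 1) * (y ^ (k + 2))⁻¹) (by group)).trans ?_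
  refine (acPair_inv₁ (v' := y * x * y * (x * y * x)⁻¹) (by rw [hr]; group)).trans ?_
  exact acPair_swap

/-- Symmetric form of Lemma 3.4: `GST(n) ~ AK(n)`. [cite: PanteleevUshakov2016, Lemma 3.4] -/
theorem isAndrewsCurtisEquivalent_gstPresentation_akbulutKirby (k : ℕ) :
    IsAndrewsCurtisEquivalent (gstPresentation (k + 2)) (akbulutKirby k) :=
  (isAndrewsCurtisEquivalent_akbulutKirby_gstPresentation k).symm

/-- **`AK(n)` and `GST(n)` have the same Andrews–Curtis class**: for every balanced presentation
`Q`, `GST(n) ~ Q ↔ AK(n) ~ Q` (`n = k + 2`).  This sharpens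
`isAndrewsCurtisEquivalent_gstPresentation_trivial_iff` (the case `Q` trivial, which only needed
the invariance of Andrews–Curtis *triviality* under relabelling). [cite: PanteleevUshakov2016, Lemma 3.4] -/
theorem isAndrewsCurtisEquivalent_gstPresentation_iff_akbulutKirby (k : ℕ)
    (Q : BalancedPresentation 2) :
    IsAndrewsCurtisEquivalent (gstPresentation (k + 2)) Q ↔
      IsAndrewsCurtisEquivalent (akbulutKirby k) Q :=
  ⟨fun h ↦ (isAndrewsCurtisEquivalent_akbulutKirby_gstPresentation k).trans h,
    fun h ↦ (isAndrewsCurtisEquivalent_gstPresentation_akbulutKirby k).trans h⟩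

/-- **Panteleev–Ushakov 2019, Lemma 3.4 as stated: `φ(AK(n)) ~ AK(n)` for the swap `φ : x ↔ y`.**
Here `φ(AK(n))` is `FreeGroup.map (swap 0 1)` applied to both relators, which is `GST(n)` with the
relators reordered and the power relator inverted (`gstPresentation_eq_swap_akbulutKirby`).
[cite: PanteleevUshakov2016, Lemma 3.4] -/
theorem isAndrewsCurtisEquivalent_akbulutKirby_swap (k : ℕ) :
    IsAndrewsCurtisEquivalent (akbulutKirby k)
      (⇑(FreeGroup.map (Equiv.swap (0 : Fin 2) 1)) ∘ akbulutKirby k) := by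
  refine (isAndrewsCurtisEquivalent_akbulutKirby_gstPresentation k).trans ?_
  rw [gstPresentation_eq_swap_akbulutKirby]
  refine acPair_swap.trans ?_
  refine (acPair_inv₀ (u' := FreeGroup.map (Equiv.swap (0 : Fin 2) 1) (akbulutKirby k 0))
    (inv_inv _).symm).trans ?_
  have e : (![FreeGroup.map (Equiv.swap (0 : Fin 2) 1) (akbulutKirby k 0),
      FreeGroup.map (Equiv.swap (0 : Fin 2) 1) (akbulutKirby k 1)] : BalancedPresentation 2) =
      ⇑(FreeGroup.map (Equiv.swap (0 : Fin 2) 1)) ∘ akbulutKirby k := by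
    ext i; fin_cases i <;> rfl
  rw [e]
  exact IsAndrewsCurtisEquivalent.refl _

/-! ### Inverting both generators -/

/-- The endomorphism `x ↦ x⁻¹, y ↦ y⁻¹` of `F₂` (an involutive automorphism). [folklore] -/
def invGenerators : FreeGroup (Fin 2) →* FreeGroup (Fin 2) :=
  FreeGroup.lift fun i ↦ (FreeGroup.of i)⁻¹

/-- `invGenerators` inverts each generator. [folklore] -/
@[simp] theorem invGenerators_of (i : Fin 2) : invGenerators (FreeGroup.of i) = (FreeGroup.of i)⁻¹ :=
  FreeGroup.lift_apply_of

/-- **`AK(n)` is Andrews–Curtis equivalent to its image under `x ↦ x⁻¹, y ↦ y⁻¹`**: the image of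
`xⁿy⁻⁽ⁿ⁺¹⁾` is `x⁻ⁿyⁿ⁺¹ = y⁻⁽ⁿ⁺¹⁾ (xⁿy⁻⁽ⁿ⁺¹⁾)⁻¹ yⁿ⁺¹` and the image of `xyx(yxy)⁻¹` is
`(yxy)⁻¹ (xyx(yxy)⁻¹)⁻¹ (yxy)`: two inversions and two conjugations (an instance of
Panteleev–Ushakov's Prop. 3.7 needing no search). [cite: PanteleevUshakov2016, Prop. 3.7] -/
theorem isAndrewsCurtisEquivalent_akbulutKirby_invGenerators (k : ℕ) :
    IsAndrewsCurtisEquivalent (akbulutKirby k) (⇑invGenerators ∘ akbulutKirby k) := by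
  set x : FreeGroup (Fin 2) := FreeGroup.of 0 with hx
  set y : FreeGroup (Fin 2) := FreeGroup.of 1 with hy
  have e : akbulutKirby k = ![x ^ (k + 2) * (y ^ (k + 3))⁻¹, x * y * x * (y * x * y)⁻¹] := rfl
  have hιx : invGenerators x = x⁻¹ := by rw [hx, invGenerators_of]
  have hιy : invGenerators y = y⁻¹ := by rw [hy, invGenerators_of]
  have fin : ⇑invGenerators ∘ akbulutKirby k =
      ![x⁻¹ ^ (k + 2) * (y⁻¹ ^ (k + 3))⁻¹, x⁻¹ * y⁻¹ * x⁻¹ * (y⁻¹ * x⁻¹ * y⁻¹)⁻¹] := by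
    rw [e, comp_vec_two]
    simp only [map_mul, map_inv, map_pow, hιx, hιy]
  rw [fin, e]
  refine (acPair_inv₀ (u' := y ^ (k + 3) * (x ^ (k + 2))⁻¹) (by group)).trans ?_
  refine (acPair_conj₀ (y ^ (k + 3))⁻¹ (u' := x⁻¹ ^ (k + 2) * (y⁻¹ ^ (k + 3))⁻¹)
    (by rw [inv_pow, inv_pow]; group)).trans ?_
  refine (acPair_inv₁ (v' := y * x * y * (x * y * x)⁻¹) (by group)).trans ?_
  exact acPair_conj₁ (y * x * y)⁻¹ (by group)

/-- Hence also the image under the composite `x ↦ y⁻¹, y ↦ x⁻¹` (swap after inverting), by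
closure under composition. [cite: PanteleevUshakov2016, Prop. 3.7] -/
theorem isAndrewsCurtisEquivalent_akbulutKirby_swap_invGenerators (k : ℕ) :
    IsAndrewsCurtisEquivalent (akbulutKirby k)
      (⇑(FreeGroup.map (Equiv.swap (0 : Fin 2) 1)) ∘ ⇑invGenerators ∘ akbulutKirby k) :=
  IsAndrewsCurtisEquivalent.comp_comp_of_comp (F := FreeGroup (Fin 2) →* FreeGroup (Fin 2))
    _ _ (isAndrewsCurtisEquivalent_akbulutKirby_swap k)
    (isAndrewsCurtisEquivalent_akbulutKirby_invGenerators k)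

end Literature.Barriers.SmoothPoincare4
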